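import Mathlib
import Summits.MatrixMultiplication.MatrixMultiplication.Theses.CondensationDistance
import Literature.Computability.AlgebraicComplexity.StandardFamiliesProofs

/-!
# `CondensationDistance.CondensationSound` (stmt-MatrixMultiplication-15939) — Negative lane, II:
# the degree bound for division SLPs; validity and the listing ORDER are load-bearing

Crux (route `CondensationDistance`, rank 5, soundness bridge): every VALID octahedral Plücker
derivation `f : Fin l → Finset (Fin (n + m'))` (each listed `n`-set is justified by an octahedron
whose five other vertices lie in the radius-1 ball or are listed EARLIER) that lists the target
`[n, 2n)` yields `Derivable ℂ (5 * l) (entries of Z) {det X}`.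

Tool (`degBound_step`, `degBound_seq`, `degBound_derivable`): in the tree model
`DivStep`/`DivSeq`/`Derivable` over `ℂ(σ) = Frac ℂ[σ]`, every element computed from the
indeterminates by a sequence of `s` Ω-steps is `p/q` with `q ≠ 0` and `deg p, deg q ≤ 2^s` (one
step — `c • x + d • y`, `x * y` or `x⁻¹` — at most doubles the bound).  Hence
(`not_derivable_det`) `det Xₙ`, of total degree `n` (tree `totalDegree_detPoly_holds`), is not
derivable from the entries in `s` steps when `2^s < n`.

Consequences for the crux (crux disprover, cycle 1, `Cruxes/CondensationSound/Disproof.lean`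
§(a2)–(a3); the crux itself is true as typed):
* `condensationSound_false_without_validity` — the crux with the validity clause deleted is false
  (`n = m' = 33`, `l = 1`, `f 0 = [33, 66)`: budget `5`, `2⁵ = 32 < 33`).
* `condensationSound_false_without_order` — the crux with "listed earlier" (`j < i ∧ f j = J`)
  weakened to "listed" (`f j = J`) is false: the six vertices `S ∪ e`, `e ⊂ {p,q,u,v}`, `|e| = 2`,
  of ONE octahedron justify each other (`circular_certificate`), a circular "derivation" of length
  `6` of the target for every `n ≥ 2`; at `n = 2³⁰ + 1` the degree bound refutes `Derivable ℂ 30`.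
  So a proof of the crux must run an induction along the listing order; closure of the listed
  family under the exchange rule is not enough.
-/

set_option linter.dupNamespace false

namespace Summit.MatrixMultiplication.MatrixMultiplication.Theorems

namespace CondensationSoundNeg

open MvPolynomial Literature.Computability.AlgebraicComplexity

/-! ## The degree bound -/

/-- **One Ω-step at most doubles the degree budget.**  If every available element is `p/q` with
`q ≠ 0`, `deg p, deg q ≤ 2^s` (constants are `C c / 1`), then a `DivStep` — `c • x + d • y =
(c p₁q₂ + d p₂q₁)/(q₁q₂)`, `x y = p₁p₂/(q₁q₂)`, `x⁻¹ = q₁/p₁` — is `p/q` with degrees `≤ 2^(s+1)`.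
[folklore] -/
theorem degBound_step {σ : Type*} {s : ℕ} {A : Set (FractionRing (MvPolynomial σ ℂ))}
    (hA : ∀ a ∈ A, ∃ p q : MvPolynomial σ ℂ, q ≠ 0 ∧
      algebraMap (MvPolynomial σ ℂ) (FractionRing (MvPolynomial σ ℂ)) q * a =
        algebraMap (MvPolynomial σ ℂ) (FractionRing (MvPolynomial σ ℂ)) p ∧
      p.totalDegree ≤ 2 ^ s ∧ q.totalDegree ≤ 2 ^ s)
    {v : FractionRing (MvPolynomial σ ℂ)} (hv : DivStep ℂ A v) :
    ∃ p q : MvPolynomial σ ℂ, q ≠ 0 ∧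
      algebraMap (MvPolynomial σ ℂ) (FractionRing (MvPolynomial σ ℂ)) q * v =
        algebraMap (MvPolynomial σ ℂ) (FractionRing (MvPolynomial σ ℂ)) p ∧
      p.totalDegree ≤ 2 ^ (s + 1) ∧ q.totalDegree ≤ 2 ^ (s + 1) := by
  -- available elements and constants are `p/q` with degrees `≤ 2^s`
  have key : ∀ x ∈ A ∪ Set.range (algebraMap ℂ (FractionRing (MvPolynomial σ ℂ))),
      ∃ p q : MvPolynomial σ ℂ, q ≠ 0 ∧
        algebraMap (MvPolynomial σ ℂ) (FractionRing (MvPolynomial σ ℂ)) q * x =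
          algebraMap (MvPolynomial σ ℂ) (FractionRing (MvPolynomial σ ℂ)) p ∧
        p.totalDegree ≤ 2 ^ s ∧ q.totalDegree ≤ 2 ^ s := by
    rintro x (hx | ⟨c, rfl⟩)
    · exact hA x hx
    · refine ⟨C c, 1, one_ne_zero, ?_, by simp, by simp⟩
      rw [IsScalarTower.algebraMap_apply ℂ (MvPolynomial σ ℂ) (FractionRing (MvPolynomial σ ℂ)),
        MvPolynomial.algebraMap_eq]
      simp
  set ιR := algebraMap (MvPolynomial σ ℂ) (FractionRing (MvPolynomial σ ℂ)) with hιR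
  obtain ⟨x, hx, y, hy, hxy⟩ := hv
  obtain ⟨p₁, q₁, hq₁, e₁, dp₁, dq₁⟩ := key x hx
  obtain ⟨p₂, q₂, hq₂, e₂, dp₂, dq₂⟩ := key y hy
  have h2 : 2 ^ (s + 1) = 2 ^ s + 2 ^ s := by ring
  have hmul : ∀ a b : MvPolynomial σ ℂ, a.totalDegree ≤ 2 ^ s → b.totalDegree ≤ 2 ^ s →
      (a * b).totalDegree ≤ 2 ^ (s + 1) := fun a b ha hb =>
    (totalDegree_mul a b).trans (by omega)
  have hle : 2 ^ s ≤ 2 ^ (s + 1) := by omega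
  rcases hxy with ⟨c, d, rfl⟩ | rfl | ⟨hx0, rfl⟩
  · -- linear combination
    refine ⟨C c * (p₁ * q₂) + C d * (p₂ * q₁), q₁ * q₂, mul_ne_zero hq₁ hq₂, ?_, ?_,
      hmul _ _ dq₁ dq₂⟩
    · rw [Algebra.smul_def, Algebra.smul_def,
        IsScalarTower.algebraMap_apply ℂ (MvPolynomial σ ℂ) (FractionRing (MvPolynomial σ ℂ)) c,
        IsScalarTower.algebraMap_apply ℂ (MvPolynomial σ ℂ) (FractionRing (MvPolynomial σ ℂ)) d,
        MvPolynomial.algebraMap_eq]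
      simp only [map_add, map_mul]
      linear_combination (ιR (C c) * ιR q₂) * e₁ + (ιR (C d) * ιR q₁) * e₂
    · refine (totalDegree_add _ _).trans (max_le ?_ ?_)
      · refine (totalDegree_mul _ _).trans ?_
        rw [totalDegree_C, zero_add]
        exact hmul _ _ dp₁ dq₂
      · refine (totalDegree_mul _ _).trans ?_
        rw [totalDegree_C, zero_add]
        exact hmul _ _ dp₂ dq₁
  · -- product
    refine ⟨p₁ * p₂, q₁ * q₂, mul_ne_zero hq₁ hq₂, ?_, hmul _ _ dp₁ dp₂, hmul _ _ dq₁ dq₂⟩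
    simp only [map_mul]
    linear_combination (ιR q₂ * y) * e₁ + (ιR p₁) * e₂
  · -- inverse
    have hp₁ : p₁ ≠ 0 := by
      rintro rfl
      rw [map_zero, mul_eq_zero] at e₁
      rcases e₁ with h0 | h0
      · exact hq₁ ((IsFractionRing.injective (MvPolynomial σ ℂ)
          (FractionRing (MvPolynomial σ ℂ))) (by rw [h0, map_zero]))
      · exact hx0 h0
    refine ⟨q₁, p₁, hp₁, ?_, dq₁.trans hle, dp₁.trans hle⟩
    rw [← e₁, mul_assoc, mul_inv_cancel₀ hx0, mul_one]

/-- **The degree budget along a computation sequence**: starting from available elements of degree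
budget `2^s`, the entries of a `DivSeq` of length `k` have degree budget `2^(s+k)`. [folklore] -/
theorem degBound_seq {σ : Type*} : ∀ (l : List (FractionRing (MvPolynomial σ ℂ)))
    (A : Set (FractionRing (MvPolynomial σ ℂ))) (s : ℕ),
    (∀ a ∈ A, ∃ p q : MvPolynomial σ ℂ, q ≠ 0 ∧
      algebraMap (MvPolynomial σ ℂ) (FractionRing (MvPolynomial σ ℂ)) q * a =
        algebraMap (MvPolynomial σ ℂ) (FractionRing (MvPolynomial σ ℂ)) p ∧
      p.totalDegree ≤ 2 ^ s ∧ q.totalDegree ≤ 2 ^ s) →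
    DivSeq ℂ A l → ∀ x ∈ l, ∃ p q : MvPolynomial σ ℂ, q ≠ 0 ∧
      algebraMap (MvPolynomial σ ℂ) (FractionRing (MvPolynomial σ ℂ)) q * x =
        algebraMap (MvPolynomial σ ℂ) (FractionRing (MvPolynomial σ ℂ)) p ∧
      p.totalDegree ≤ 2 ^ (s + l.length) ∧ q.totalDegree ≤ 2 ^ (s + l.length)
  | [], _, _, _, _, x, hx => by simp at hx
  | v :: l, A, s, hA, hl, x, hx => by
      rw [divSeq_cons] at hl
      have hv := degBound_step hA hl.1
      have hA' : ∀ a ∈ insert v A, ∃ p q : MvPolynomial σ ℂ, q ≠ 0 ∧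
          algebraMap (MvPolynomial σ ℂ) (FractionRing (MvPolynomial σ ℂ)) q * a =
            algebraMap (MvPolynomial σ ℂ) (FractionRing (MvPolynomial σ ℂ)) p ∧
          p.totalDegree ≤ 2 ^ (s + 1) ∧ q.totalDegree ≤ 2 ^ (s + 1) := by
        rintro a (rfl | ha)
        · exact hv
        · obtain ⟨p, q, hq, e, dp, dq⟩ := hA a ha
          have : 2 ^ s ≤ 2 ^ (s + 1) := Nat.pow_le_pow_right (by norm_num) (Nat.le_succ s)
          exact ⟨p, q, hq, e, dp.trans this, dq.trans this⟩
      have hmono : 2 ^ (s + 1) ≤ 2 ^ (s + (v :: l).length) :=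
        Nat.pow_le_pow_right (by norm_num) (by simp)
      rcases List.mem_cons.mp hx with rfl | hx'
      · obtain ⟨p, q, hq, e, dp, dq⟩ := hv
        exact ⟨p, q, hq, e, dp.trans hmono, dq.trans hmono⟩
      · obtain ⟨p, q, hq, e, dp, dq⟩ := degBound_seq l (insert v A) (s + 1) hA' hl.2 x hx'
        have : 2 ^ (s + 1 + l.length) ≤ 2 ^ (s + (v :: l).length) :=
          Nat.pow_le_pow_right (by norm_num) (by simp only [List.length_cons]; omega)
        exact ⟨p, q, hq, e, dp.trans this, dq.trans this⟩

/-- **Degree bound for `Derivable`** (the easy half of Strassen's degree bound, in the tree model):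
everything derivable in `s` steps from the indeterminates of `ℂ[σ]` is `p/q` with `q ≠ 0` and
`deg p, deg q ≤ 2^s`. [folklore] -/
theorem degBound_derivable {σ : Type*} {s : ℕ} {B : Set (FractionRing (MvPolynomial σ ℂ))}
    (h : Derivable ℂ s
      (Set.range fun v : σ => algebraMap (MvPolynomial σ ℂ) (FractionRing (MvPolynomial σ ℂ)) (X v))
      B) :
    ∀ b ∈ B, ∃ p q : MvPolynomial σ ℂ, q ≠ 0 ∧
      algebraMap (MvPolynomial σ ℂ) (FractionRing (MvPolynomial σ ℂ)) q * b =
        algebraMap (MvPolynomial σ ℂ) (FractionRing (MvPolynomial σ ℂ)) p ∧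
      p.totalDegree ≤ 2 ^ s ∧ q.totalDegree ≤ 2 ^ s := by
  have hA : ∀ a ∈ (Set.range fun v : σ =>
      algebraMap (MvPolynomial σ ℂ) (FractionRing (MvPolynomial σ ℂ)) (X v)),
      ∃ p q : MvPolynomial σ ℂ, q ≠ 0 ∧
        algebraMap (MvPolynomial σ ℂ) (FractionRing (MvPolynomial σ ℂ)) q * a =
          algebraMap (MvPolynomial σ ℂ) (FractionRing (MvPolynomial σ ℂ)) p ∧
        p.totalDegree ≤ 2 ^ 0 ∧ q.totalDegree ≤ 2 ^ 0 := by
    rintro a ⟨v, rfl⟩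
    exact ⟨X v, 1, one_ne_zero, by simp, by simp [totalDegree_X], by simp⟩
  obtain ⟨l, hl, hlen, hsub⟩ := h
  have hs : 2 ^ 0 ≤ 2 ^ s := Nat.pow_le_pow_right (by norm_num) (Nat.zero_le _)
  intro b hb
  rcases hsub hb with (hb' | ⟨c, rfl⟩) | hb'
  · obtain ⟨p, q, hq, e, dp, dq⟩ := hA b hb'
    exact ⟨p, q, hq, e, dp.trans hs, dq.trans hs⟩
  · refine ⟨C c, 1, one_ne_zero, ?_, by simp, by simp⟩
    rw [IsScalarTower.algebraMap_apply ℂ (MvPolynomial σ ℂ) (FractionRing (MvPolynomial σ ℂ)),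
      MvPolynomial.algebraMap_eq]
    simp
  · obtain ⟨p, q, hq, e, dp, dq⟩ := degBound_seq l _ 0 hA hl b hb'
    have : 2 ^ (0 + l.length) ≤ 2 ^ s := Nat.pow_le_pow_right (by norm_num) (by omega)
    exact ⟨p, q, hq, e, dp.trans this, dq.trans this⟩

/-- The determinant of the generic `n × n` matrix (the crux's `X` at `m' = n`, columns through
`Fin.castLE (le_refl n)`) has total degree `n` (tree: `totalDegree_detPoly_holds`). [folklore] -/
theorem totalDegree_det_generic (n : ℕ) :
    (Matrix.det (Matrix.of fun i j : Fin n =>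
      (MvPolynomial.X (i, Fin.castLE (le_refl n) j) : MvPolynomial (Fin n × Fin n) ℂ))).totalDegree
        = n := by
  have hM : (Matrix.of fun i j : Fin n =>
      (MvPolynomial.X (i, Fin.castLE (le_refl n) j) : MvPolynomial (Fin n × Fin n) ℂ)) =
      Matrix.mvPolynomialX (Fin n) (Fin n) ℂ := by
    ext i j : 1
    simp
  rw [hM]
  have h2 := @totalDegree_detPoly_holds (Fin n) _ _ ℂ
  unfold totalDegree_detPoly at h2
  have h3 : (detPoly (Fin n) ℂ).totalDegree = Fintype.card (Fin n) := h2
  rwa [Fintype.card_fin] at h3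

/-- **No division SLP of `s` steps computes `det Xₙ` from the entries when `2^s < n`** (the crux's
conclusion shape at `m' = n`): by `degBound_derivable`, `q · det Xₙ = p` with `deg p ≤ 2^s`, but
`deg (q · det Xₙ) = deg q + n > 2^s` in the domain `ℂ[Z]`. [folklore] -/
theorem not_derivable_det {n s : ℕ} (hn : 2 ^ s < n) :
    ¬ Derivable ℂ s
      (Set.range fun p : Fin n × Fin n =>
        algebraMap (MvPolynomial (Fin n × Fin n) ℂ) (FractionRing (MvPolynomial (Fin n × Fin n) ℂ))
          (MvPolynomial.X p))
      {algebraMap (MvPolynomial (Fin n × Fin n) ℂ) (FractionRing (MvPolynomial (Fin n × Fin n) ℂ))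
        (Matrix.det (Matrix.of fun i j : Fin n => MvPolynomial.X (i, Fin.castLE (le_refl n) j)))} := by
  intro hD
  obtain ⟨p, q, hq, e, dp, -⟩ := degBound_derivable hD _ (Set.mem_singleton _)
  rw [← map_mul] at e
  have e' := IsFractionRing.injective (MvPolynomial (Fin n × Fin n) ℂ)
    (FractionRing (MvPolynomial (Fin n × Fin n) ℂ)) e
  have hdet := totalDegree_det_generic n
  have hdet0 : Matrix.det (Matrix.of fun i j : Fin n =>
      (MvPolynomial.X (i, Fin.castLE (le_refl n) j) : MvPolynomial (Fin n × Fin n) ℂ)) ≠ 0 := by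
    intro h0
    rw [h0, totalDegree_zero] at hdet
    omega
  have := congrArg MvPolynomial.totalDegree e'
  rw [totalDegree_mul_of_isDomain hq hdet0, hdet] at this
  omega

/-! ## Validity is load-bearing -/

/-- **The validity clause is load-bearing for `CondensationSound`.**  The crux with the validity
hypothesis deleted (target clause, input set, conclusion and budget verbatim) is false: with
`l = 1`, `f 0 = [n, 2n)` it would give `Derivable ℂ 5 (entries) {det Xₙ}` for every `n`, and the
degree bound refutes this at `n = m' = 33 > 2⁵`. [folklore] -/
theorem condensationSound_false_without_validity :
    ¬ ∀ (n m' : ℕ) (h : n ≤ m') (l : ℕ) (f : Fin l → Finset (Fin (n + m'))),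
      (∃ i : Fin l, f i = Finset.univ.filter fun x : Fin (n + m') => n ≤ x.val ∧ x.val < 2 * n) →
      Literature.Computability.AlgebraicComplexity.Derivable ℂ (5 * l)
        (Set.range fun p : Fin n × Fin m' =>
          algebraMap (MvPolynomial (Fin n × Fin m') ℂ) (FractionRing (MvPolynomial (Fin n × Fin m') ℂ))
            (MvPolynomial.X p))
        {algebraMap (MvPolynomial (Fin n × Fin m') ℂ) (FractionRing (MvPolynomial (Fin n × Fin m') ℂ))
          (Matrix.det (Matrix.of fun i j : Fin n => MvPolynomial.X (i, Fin.castLE h j)))} :=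
  fun H => not_derivable_det (n := 33) (s := 5) (by norm_num)
    (H 33 33 le_rfl 1 (fun _ => Finset.univ.filter fun x : Fin (33 + 33) => 33 ≤ x.val ∧ x.val < 2 * 33)
      ⟨0, rfl⟩)

/-! ## The listing order is load-bearing: one octahedron certifies itself -/

/-- The exchange step at the vertex `S ∪ {a, b}` of the octahedron over `S` spanned by four
distinct points `a, b, c, d ∉ S`, with `(p, q, u, v) := (a, b, c, d)`: its five mates are the other
five vertices `S ∪ {c,b}, S ∪ {d,b}, S ∪ {c,a}, S ∪ {d,a}, S ∪ {c,d}`. [folklore] -/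
theorem oct_step {α : Type*} [DecidableEq α] (S : Finset α) {a b c d : α} (hab : a ≠ b)
    (hac : a ≠ c) (had : a ≠ d) (hbc : b ≠ c) (hbd : b ≠ d)
    (ha : a ∉ S) (hb : b ∉ S) (hc : c ∉ S) (hd : d ∉ S) :
    a ∈ insert a (insert b S) ∧ b ∈ insert a (insert b S) ∧
    c ∉ insert a (insert b S) ∧ d ∉ insert a (insert b S) ∧
    insert c ((insert a (insert b S)).erase a) = insert c (insert b S) ∧
    insert d ((insert a (insert b S)).erase a) = insert d (insert b S) ∧
    insert c ((insert a (insert b S)).erase b) = insert c (insert a S) ∧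
    insert d ((insert a (insert b S)).erase b) = insert d (insert a S) ∧
    insert c (insert d (((insert a (insert b S)).erase a).erase b)) = insert c (insert d S) := by
  have h1 : (insert a (insert b S)).erase a = insert b S :=
    Finset.erase_insert (by simp only [Finset.mem_insert]; rintro (h | h); exacts [hab h, ha h])
  have h2 : (insert a (insert b S)).erase b = insert a S := by
    rw [Finset.erase_insert_of_ne hab, Finset.erase_insert hb]
  have h3 : ((insert a (insert b S)).erase a).erase b = S := by rw [h1, Finset.erase_insert hb]
  refine ⟨by simp, by simp, by simp [hac.symm, hbc.symm, hc], by simp [had.symm, hbd.symm, hd],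
    ?_, ?_, ?_, ?_, ?_⟩
  · rw [h1]
  · rw [h1]
  · rw [h2]
  · rw [h2]
  · rw [h3]

/-- Packaging of one step of the circular certificate for a listing `f : Fin 6 → _`: if `f i` is the
vertex `S ∪ {a,b}` and the other five vertices are listed (anywhere), then `f i` is justified in the
sense of the route's rule with "listed earlier" weakened to "listed". [folklore] -/
theorem circular_step {α : Type*} [DecidableEq α] (S : Finset α) (P : Finset α → Prop)
    {f : Fin 6 → Finset α} {i : Fin 6} {a b c d : α}
    (hi : f i = insert a (insert b S)) (hab : a ≠ b) (hac : a ≠ c) (had : a ≠ d) (hbc : b ≠ c)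
    (hbd : b ≠ d) (hcd : c ≠ d) (ha : a ∉ S) (hb : b ∉ S) (hc : c ∉ S) (hd : d ∉ S)
    (j₁ j₂ j₃ j₄ j₅ : Fin 6) (e₁ : f j₁ = insert c (insert b S)) (e₂ : f j₂ = insert d (insert b S))
    (e₃ : f j₃ = insert c (insert a S)) (e₄ : f j₄ = insert d (insert a S))
    (e₅ : f j₅ = insert c (insert d S)) :
    ∃ p ∈ f i, ∃ q ∈ f i, p ≠ q ∧ ∃ u ∉ f i, ∃ v ∉ f i, u ≠ v ∧
      ∀ J ∈ [insert u ((f i).erase p), insert v ((f i).erase p), insert u ((f i).erase q),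
        insert v ((f i).erase q), insert u (insert v (((f i).erase p).erase q))],
        P J ∨ ∃ j : Fin 6, f j = J := by
  obtain ⟨h₁, h₂, h₃, h₄, m₁, m₂, m₃, m₄, m₅⟩ := oct_step S hab hac had hbc hbd ha hb hc hd
  rw [hi]
  refine ⟨a, h₁, b, h₂, hab, c, h₃, d, h₄, hcd, ?_⟩
  intro J hJ
  simp only [List.mem_cons, List.not_mem_nil, or_false] at hJ
  right
  rcases hJ with rfl | rfl | rfl | rfl | rfl
  · exact ⟨j₁, e₁.trans m₁.symm⟩
  · exact ⟨j₂, e₂.trans m₂.symm⟩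
  · exact ⟨j₃, e₃.trans m₃.symm⟩
  · exact ⟨j₄, e₄.trans m₄.symm⟩
  · exact ⟨j₅, e₅.trans m₅.symm⟩

/-- **The circular certificate in `J(2n, n)`** (`m' = n`, `n ≥ 2`).  There is a listing
`f : Fin 6 → Finset (Fin (n + n))` of the six vertices of the octahedron over `S = [n+2, 2n)`
spanned by `p = n`, `q = n + 1`, `u = 0`, `v = 1`, whose first entry is the target `[n, 2n)`, and
which is valid for the route's rule with "listed earlier (`j < i`)" weakened to "listed": every
vertex is justified by the other five. [folklore] -/
theorem circular_certificate (n : ℕ) (hn : 2 ≤ n) :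
    ∃ f : Fin 6 → Finset (Fin (n + n)),
      (∀ i : Fin 6, ∃ p ∈ f i, ∃ q ∈ f i, p ≠ q ∧ ∃ u ∉ f i, ∃ v ∉ f i, u ≠ v ∧
        ∀ J ∈ [insert u ((f i).erase p), insert v ((f i).erase p), insert u ((f i).erase q),
          insert v ((f i).erase q), insert u (insert v (((f i).erase p).erase q))],
          (J.card = n ∧ (J.filter fun x : Fin (n + n) => n ≤ x.val).card ≤ 1) ∨
            ∃ j : Fin 6, f j = J) ∧
      f 0 = Finset.univ.filter fun x : Fin (n + n) => n ≤ x.val ∧ x.val < 2 * n := by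
  set T : Finset (Fin (n + n)) := Finset.univ.filter fun x : Fin (n + n) => n ≤ x.val ∧ x.val < 2 * n
    with hT
  set p : Fin (n + n) := ⟨n, by omega⟩
  set q : Fin (n + n) := ⟨n + 1, by omega⟩
  set u : Fin (n + n) := ⟨0, by omega⟩
  set v : Fin (n + n) := ⟨1, by omega⟩
  set S := (T.erase p).erase q with hS
  have hpT : p ∈ T := by simp [hT, p]; omega
  have hqT : q ∈ T.erase p := by
    simp [hT, q, p, Fin.ext_iff]; omega
  have huT : u ∉ T := by simp [hT, u]
  have hvT : v ∉ T := by simp [hT, v]; omega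
  have hp : p ∉ S := by simp [hS, p, q, Fin.ext_iff]
  have hq : q ∉ S := by simp [hS]
  have hu : u ∉ S := fun h => huT (Finset.mem_of_mem_erase (Finset.mem_of_mem_erase h))
  have hv : v ∉ S := fun h => hvT (Finset.mem_of_mem_erase (Finset.mem_of_mem_erase h))
  have hpq : p ≠ q := by simp [p, q, Fin.ext_iff]
  have hpu : p ≠ u := by simp [p, u, Fin.ext_iff]; omega
  have hpv : p ≠ v := by simp [p, v, Fin.ext_iff]; omega
  have hqu : q ≠ u := by simp [q, u, Fin.ext_iff]
  have hqv : q ≠ v := by simp [q, v, Fin.ext_iff]; omega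
  have huv : u ≠ v := by simp [u, v, Fin.ext_iff]
  -- the six vertices, target first: pq, qu, qv, pu, pv, uv
  set f : Fin 6 → Finset (Fin (n + n)) := ![insert p (insert q S), insert q (insert u S),
    insert q (insert v S), insert p (insert u S), insert p (insert v S), insert u (insert v S)] with hf
  have f0 : f 0 = insert p (insert q S) := rfl
  have f1 : f 1 = insert q (insert u S) := rfl
  have f2 : f 2 = insert q (insert v S) := rfl
  have f3 : f 3 = insert p (insert u S) := rfl
  have f4 : f 4 = insert p (insert v S) := rfl
  have f5 : f 5 = insert u (insert v S) := rfl
  have c0 : f 0 = insert q (insert p S) := f0.trans (Finset.insert_comm p q S)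
  have c1 : f 1 = insert u (insert q S) := f1.trans (Finset.insert_comm q u S)
  have c2 : f 2 = insert v (insert q S) := f2.trans (Finset.insert_comm q v S)
  have c3 : f 3 = insert u (insert p S) := f3.trans (Finset.insert_comm p u S)
  have c4 : f 4 = insert v (insert p S) := f4.trans (Finset.insert_comm p v S)
  have c5 : f 5 = insert v (insert u S) := f5.trans (Finset.insert_comm u v S)
  set P : Finset (Fin (n + n)) → Prop := fun J =>
    J.card = n ∧ (J.filter fun x : Fin (n + n) => n ≤ x.val).card ≤ 1 with hP
  refine ⟨f, ?_, ?_⟩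
  · intro i
    show ∃ p ∈ f i, ∃ q ∈ f i, p ≠ q ∧ ∃ u ∉ f i, ∃ v ∉ f i, u ≠ v ∧
      ∀ J ∈ [insert u ((f i).erase p), insert v ((f i).erase p), insert u ((f i).erase q),
        insert v ((f i).erase q), insert u (insert v (((f i).erase p).erase q))],
        P J ∨ ∃ j : Fin 6, f j = J
    fin_cases i
    · -- vertex pq, step (p,q,u,v): mates uq vq up vp uv
      exact circular_step S P f0 hpq hpu hpv hqu hqv huv hp hq hu hv 1 2 3 4 5 c1 c2 c3 c4 f5
    · -- vertex qu, step (q,u,p,v): mates pu vu pq vq pv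
      exact circular_step S P f1 hqu hpq.symm hqv hpu.symm huv hpv hq hu hp hv 3 5 0 2 4 f3 c5 f0
        c2 f4
    · -- vertex qv, step (q,v,p,u): mates pv uv pq uq pu
      exact circular_step S P f2 hqv hpq.symm hqu hpv.symm huv.symm hpu hq hv hp hu 4 5 0 1 3 f4 f5
        f0 c1 f3
    · -- vertex pu, step (p,u,q,v): mates qu vu qp vp qv
      exact circular_step S P f3 hpu hpq hpv hqu.symm huv hqv hp hu hq hv 1 5 0 4 2 f1 c5 c0 c4 f2
    · -- vertex pv, step (p,v,q,u): mates qv uv qp up qu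
      exact circular_step S P f4 hpv hpq hpu hqv.symm huv.symm hqu hp hv hq hu 2 5 0 3 1 f2 f5 c0
        c3 f1
    · -- vertex uv, step (u,v,p,q): mates pv qv pu qu pq
      exact circular_step S P f5 huv hpu.symm hqu.symm hpv.symm hqv.symm hpq hu hv hp hq 4 2 3 1 0
        f4 f2 f3 f1 f0
  · rw [f0, hS, Finset.insert_erase hqT, Finset.insert_erase hpT]

/-- **The listing ORDER is load-bearing for `CondensationSound`.**  The crux with "listed earlier"
(`∃ j, j < i ∧ f j = J`) weakened to "listed" (`∃ j, f j = J`), everything else verbatim, is false: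
by `circular_certificate` it would give `Derivable ℂ (5 * 6) (entries) {det Xₙ}` for every `n ≥ 2`
(`m' = n`), and the degree bound (`not_derivable_det`) refutes this at `n = 2³⁰ + 1`. [folklore] -/
theorem condensationSound_false_without_order :
    ¬ ∀ (n m' : ℕ) (h : n ≤ m') (l : ℕ) (f : Fin l → Finset (Fin (n + m'))),
      (∀ i : Fin l, ∃ p ∈ f i, ∃ q ∈ f i, p ≠ q ∧ ∃ u ∉ f i, ∃ v ∉ f i, u ≠ v ∧
        ∀ J ∈ [insert u ((f i).erase p), insert v ((f i).erase p), insert u ((f i).erase q),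
          insert v ((f i).erase q), insert u (insert v (((f i).erase p).erase q))],
          (J.card = n ∧ (J.filter fun x : Fin (n + m') => n ≤ x.val).card ≤ 1) ∨
            ∃ j : Fin l, f j = J) →
      (∃ i : Fin l, f i = Finset.univ.filter fun x : Fin (n + m') => n ≤ x.val ∧ x.val < 2 * n) →
      Literature.Computability.AlgebraicComplexity.Derivable ℂ (5 * l)
        (Set.range fun p : Fin n × Fin m' =>
          algebraMap (MvPolynomial (Fin n × Fin m') ℂ) (FractionRing (MvPolynomial (Fin n × Fin m') ℂ))
            (MvPolynomial.X p))
        {algebraMap (MvPolynomial (Fin n × Fin m') ℂ) (FractionRing (MvPolynomial (Fin n × Fin m') ℂ))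
          (Matrix.det (Matrix.of fun i j : Fin n => MvPolynomial.X (i, Fin.castLE h j)))} := by
  intro H
  obtain ⟨f, hf, hf0⟩ := circular_certificate (2 ^ 30 + 1) (by norm_num)
  exact not_derivable_det (n := 2 ^ 30 + 1) (s := 30) (by norm_num)
    (H (2 ^ 30 + 1) (2 ^ 30 + 1) le_rfl 6 f hf ⟨0, hf0⟩)

end CondensationSoundNeg

end Summit.MatrixMultiplication.MatrixMultiplication.Theorems
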